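import Literature.Analysis.FluidPDE.EulerTorusShortTimeProofs
import Literature.Analysis.FluidPDE.OnsagerBDSVMainReduction
import HarnessLib

/-!
# Discharges of named facts of `OnsagerBDSVGluing.lean`

`Literature/Analysis/FluidPDE/OnsagerBDSVGluingHolds.lean` — proofs-only sibling of
`OnsagerBDSVGluing.lean` (no definitions, no named facts). Each theorem below closes a named
fact `X : Prop` of that file as `X_holds : X` by composing an ACCEPTED reduction theorem of
the tree with the ACCEPTED unconditional `_holds` discharges of all of its hypotheses; nothing
is re-proved and no statement is changed. Recorded by the librarian sweep g25 (2026-08-16,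
pass 5c: facts dischargeable in one line from the tree's own lemmas), so that the facts
census, `#h21_route_deps` and the cone guardrail see these facts as theorems.

Discharged here:

* `localEulerHolder_holds` := `localEulerHolder_of_shortTime` `eulerSmoothShortTime_holds`
  (`OnsagerBDSVMainReduction.lean`).

## References

* [BuckmasterEtAl2018] — see `lean/references.bib` and the docstring of the fact in `OnsagerBDSVGluing.lean`.
-/

namespace Literature.Analysis.FluidPDE.BDSV

/-- **Discharge of the named fact `localEulerHolder`** (`OnsagerBDSVGluing.lean`): Local existence
for the Euler equations in Hölder spaces (BDSV Prop. 3.1, quoted from Majda–Bertozzi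
[MaBe2002]: "For any `α > 0` there exists a constant `c = c(α) > 0` with the following
property. … — obtained as `localEulerHolder_of_shortTime` applied to the tree's unconditional
discharge `eulerSmoothShortTime_holds` of its hypothesis (reduction in
`OnsagerBDSVMainReduction.lean`).
[cite: BuckmasterEtAl2018, Prop. 3.1] -/
theorem localEulerHolder_holds :
    localEulerHolder :=
  localEulerHolder_of_shortTime Literature.Analysis.FluidPDE.Torus.eulerSmoothShortTime_holds

end Literature.Analysis.FluidPDE.BDSV
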